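import Summits.CriticalPhenomena.PercolationContinuityZ3.Theorems.PercNearOneGluingNoHeavyLowerTailSunflowerGadgetModel
import Summits.CriticalPhenomena.PercolationContinuityZ3.Theorems.PercNearOneGluingNoHeavyLowerTailSunflowerTypeModelLemma
import Mathlib.Data.List.Permutation
import Mathlib.Data.Fintype.Pi
import Mathlib.Data.Finset.Powerset
import Mathlib.Data.Finset.Sigma
import Mathlib.Data.Nat.Factorial.Basic
import Mathlib.Algebra.Order.BigOperators.Group.Finset
import HarnessLib
import HarnessLib.Audit

/-!
# `NoHeavyLowerTail` (crux stmt-CriticalPhenomena-4575), abstract sunflower cubic: THE GADGET MODEL — scheme-independent COUNTING: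
# the weighted inequality `GadgetModel.Model.WeightedLemma` follows from ANY "coded injection" of BAD configurations into GOOD ones

Support file (seat `prim-ineq-prove-1` gen 72; `--supports stmt-CriticalPhenomena-4575`).  No `sorry`, no named facts.
Memo: run/shared/lean/prim/prim-ineq-prove-1/FINDING-DONATION-prove1-g72.md.

WHAT THIS FILE ISOLATES.  Every injection scheme for `GadgetModelLemma` studied in the memo (gen 40's rotation, the donation chains and
donation trees of gen 72) has the same counting skeleton: to each BAD configuration `S` one assigns a GOOD image `ψ S` with the same
multiplicity profile and a CODE — a repetition-free list of slots of length `|nonA S|` whose head is the unique non-A slot of `ψ S` — such that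
two BAD configurations with the same image whose codes are both prefixes of one common list coincide ("prefix-free decoding").  This file
proves, once and for all, that such data imply `Σ_{BAD} (K − |nonA S|)! ≤ (K−1)!·#GOOD` for every profile (`weightedLemma_of_codeInjection`):
the map `(S, L) ↦ (ψ S, L)` on pairs (BAD configuration, enumeration of all slots extending its code) is injective into pairs (GOOD
configuration, enumeration starting at its non-A slot); the fibres have `(K − |nonA S|)!` resp. at most `(K−1)!` elements.  The combinatorial
heart of any future proof of `GadgetModelLemma` is thereby reduced to exhibiting `ψ` and `code` with `GadgetModel.Model.CodeInjection`.
-/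

namespace Summit.CriticalPhenomena.PercolationContinuityZ3.Theorems.SunflowerPartition

namespace GadgetModel

namespace Model

open Finset Nat TypeModel.Model

variable {K : ℕ} {ι Λ : Type*} (M : Model K ι Λ)

/-- A **coded injection** for the gadget model `M`: a GOOD image `ψ S` and a code `code S` for every BAD configuration `S`, with
(i) multiplicities preserved, (ii) `ψ S` GOOD and the head of the code equal to its non-A slot, (iii) the code repetition-free of length
`|nonA S|`, (iv) PREFIX-FREE DECODING: two BAD configurations with equal images whose codes are prefixes of a common list are equal.
(A `Type`-valued record of proofs, used only as a hypothesis.) [this work] -/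
structure CodeInjection (ψ : (ι → Finset (Fin K)) → (ι → Finset (Fin K))) (code : (ι → Finset (Fin K)) → List (Fin K)) where
  card_psi : ∀ S, M.Bad S → ∀ x, (ψ S x).card = (S x).card
  good_psi : ∀ S, M.Bad S → ∃ z, M.nonA (ψ S) = {z} ∧ ¬ M.IsP (ψ S) z ∧ (code S).head? = some z
  nodup_code : ∀ S, M.Bad S → (code S).Nodup
  length_code : ∀ S, M.Bad S → (code S).length = (M.nonA S).card
  inj : ∀ S S' (L : List (Fin K)), M.Bad S → M.Bad S' → code S <+: L → code S' <+: L → ψ S = ψ S' → S = S'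

variable {M}
variable {ψ : (ι → Finset (Fin K)) → (ι → Finset (Fin K))} {code : (ι → Finset (Fin K)) → List (Fin K)}

section Counting

variable [Fintype ι] [DecidableEq ι]

/-- Domain of the keyed map: BAD configurations of profile `m` with an enumeration of all slots extending the code. [this work] -/
noncomputable def badKeysC (M : Model K ι Λ) (code : (ι → Finset (Fin K)) → List (Fin K)) (m : ι → ℕ) :
    Finset (Σ _ : ι → Finset (Fin K), List (Fin K)) := by
  classical
  exact ((confs m).filter fun S => M.Bad S).sigma fun S => (enumsOf univ).filter fun L => code S <+: L

/-- Codomain: GOOD configurations of profile `m` with an enumeration of all slots starting at the non-A slot. [this work] -/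
noncomputable def goodKeysC (M : Model K ι Λ) (m : ι → ℕ) : Finset (Σ _ : ι → Finset (Fin K), List (Fin K)) := by
  classical
  exact ((confs m).filter fun S => M.Good S).sigma fun S =>
    (enumsOf univ).filter fun L => ∃ z, M.nonA S = {z} ∧ L.head? = some z

/-- The keyed map `(S, L) ↦ (ψ S, L)` sends `badKeysC` injectively into `goodKeysC`. [this work] -/
theorem card_badKeysC_le (h : M.CodeInjection ψ code) (m : ι → ℕ) :
    (badKeysC M code m).card ≤ (goodKeysC M m).card := by
  classical
  refine Finset.card_le_card_of_injOn (fun SL => ⟨ψ SL.1, SL.2⟩) ?_ ?_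
  · intro SL hSL
    obtain ⟨S, L⟩ := SL
    simp only [badKeysC, Finset.mem_sigma, Finset.mem_filter, Finset.mem_coe] at hSL
    obtain ⟨⟨hSc, hSb⟩, hLe, hpre⟩ := hSL
    simp only [goodKeysC, Finset.mem_coe, Finset.mem_sigma, Finset.mem_filter]
    obtain ⟨z, hz, hnP, hhead⟩ := h.good_psi S hSb
    refine ⟨⟨?_, z, hz, hnP⟩, hLe, z, hz, ?_⟩
    · rw [mem_confs] at hSc ⊢; intro x; rw [h.card_psi S hSb, hSc]
    · obtain ⟨R, rfl⟩ := hpre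
      cases hc : code S with
      | nil => rw [hc] at hhead; simp at hhead
      | cons a t => rw [hc] at hhead; simp only [List.head?_cons, Option.some.injEq] at hhead; simp [hhead]
  · rintro ⟨S, L⟩ hSL ⟨S', L'⟩ hSL' hEq
    simp only [badKeysC, Finset.mem_sigma, Finset.mem_filter, Finset.mem_coe] at hSL hSL'
    simp only [Sigma.mk.injEq] at hEq
    obtain ⟨h1, h2⟩ := hEq
    have hLL : L = L' := eq_of_heq h2
    subst hLL
    have hSS : S = S' := h.inj S S' L hSL.1.2 hSL'.1.2 hSL.2.2 hSL'.2.2 h1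
    subst hSS; rfl

omit [Fintype ι] [DecidableEq ι] in
/-- Lower bound for the fibres of `badKeysC`: at least `(K - |nonA S|)!` enumerations extend the code. [this work] -/
theorem le_card_fiber_badC (h : M.CodeInjection ψ code) {S : ι → Finset (Fin K)} (hS : M.Bad S) :
    (K - (M.nonA S).card) ! ≤ ((enumsOf univ).filter fun L => code S <+: L).card := by
  classical
  have hnd : (code S).Nodup := h.nodup_code S hS
  have hlen : (code S).length = (M.nonA S).card := h.length_code S hS
  have hcardT : (code S).toFinset.card = (M.nonA S).card := by rw [List.toFinset_card_of_nodup hnd, hlen]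
  have hcard : (univ \ (code S).toFinset).card = K - (M.nonA S).card := by
    rw [Finset.card_sdiff_of_subset (Finset.subset_univ _), Finset.card_univ, Fintype.card_fin, hcardT]
  rw [← hcard, ← card_enumsOf]
  refine Finset.card_le_card_of_injOn (fun R => code S ++ R) ?_ ?_
  · intro R hR
    rw [Finset.mem_coe, mem_enumsOf] at hR
    simp only [Finset.mem_coe, Finset.mem_filter, mem_enumsOf]
    refine ⟨⟨?_, fun k => ?_⟩, List.prefix_append _ _⟩
    · refine List.Nodup.append hnd hR.1 fun k hk hk' => ?_
      have := (hR.2 k).1 hk'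
      rw [Finset.mem_sdiff, List.mem_toFinset] at this
      exact this.2 hk
    · simp only [List.mem_append, Finset.mem_univ, iff_true]
      by_cases hk : k ∈ code S
      · exact Or.inl hk
      · right; rw [hR.2 k, Finset.mem_sdiff, List.mem_toFinset]; exact ⟨Finset.mem_univ _, hk⟩
  · intro R _ R' _ hRR
    exact List.append_cancel_left hRR

omit [Fintype ι] [DecidableEq ι] in
/-- Upper bound for the fibres of `goodKeysC`: at most `(K-1)!` enumerations start at the non-A slot. [this work] -/
theorem card_fiber_goodC {S : ι → Finset (Fin K)} :
    ((enumsOf univ).filter fun L => ∃ z, M.nonA S = {z} ∧ L.head? = some z).card ≤ (K - 1) ! := by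
  classical
  by_cases hz : ∃ z, M.nonA S = {z}
  · obtain ⟨z, hz⟩ := hz
    have hcard : (univ.erase z).card = K - 1 := by
      rw [Finset.card_erase_of_mem (Finset.mem_univ _), Finset.card_univ, Fintype.card_fin]
    rw [← hcard, ← card_enumsOf]
    refine Finset.card_le_card_of_injOn List.tail ?_ ?_
    · intro L hL
      simp only [Finset.mem_coe, Finset.mem_filter, mem_enumsOf, hz, Finset.singleton_inj, exists_eq_left'] at hL
      obtain ⟨⟨hnd, hmem⟩, hhead⟩ := hL
      obtain ⟨t, rfl⟩ : ∃ t, L = z :: t := by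
        cases L with
        | nil => simp at hhead
        | cons a t => simp only [List.head?_cons, Option.some.injEq] at hhead; exact ⟨t, by rw [hhead]⟩
      rw [Finset.mem_coe, mem_enumsOf]
      refine ⟨(List.nodup_cons.1 hnd).2, fun k => ?_⟩
      rw [Finset.mem_erase]
      constructor
      · intro hk; exact ⟨fun hkz => (List.nodup_cons.1 hnd).1 (hkz ▸ hk), Finset.mem_univ _⟩
      · rintro ⟨hkz, -⟩
        exact (List.mem_cons.1 ((hmem k).2 (Finset.mem_univ k))).resolve_left hkz
    · intro L hL L' hL' hEq
      simp only [Finset.mem_coe, Finset.mem_filter, hz, Finset.singleton_inj, exists_eq_left'] at hL hL'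
      cases L with
      | nil => simp at hL
      | cons a t =>
        cases L' with
        | nil => simp at hL'
        | cons a' t' =>
          simp only [List.head?_cons, Option.some.injEq] at hL hL'
          simp only [List.tail_cons] at hEq
          rw [hL.2, hL'.2, hEq]
  · have hempty : ((enumsOf univ).filter fun L => ∃ z, M.nonA S = {z} ∧ L.head? = some z) = ∅ := by
      ext L; simp only [Finset.mem_filter, Finset.notMem_empty, iff_false, not_and]
      rintro - ⟨z, hz', -⟩; exact hz ⟨z, hz'⟩
    rw [hempty, Finset.card_empty]; exact Nat.zero_le _

open scoped Classical in
/-- **The weighted inequality from a coded injection**: if the gadget model `M` admits `ψ`, `code` with `CodeInjection`, then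
`Σ_{BAD S ∈ confs m} (K − |nonA S|)! ≤ (K−1)! · #{S ∈ confs m | Good S}` for every profile `m`. [this work] -/
theorem sum_bad_le_of_codeInjection (h : M.CodeInjection ψ code) (m : ι → ℕ) :
    ∑ S ∈ (confs m).filter (fun S => M.Bad S), (K - (M.nonA S).card) ! ≤
      (K - 1) ! * ((confs m).filter fun S => M.Good S).card := by
  classical
  have h1 : ∑ S ∈ (confs m).filter (fun S => M.Bad S), (K - (M.nonA S).card) ! ≤ (badKeysC M code m).card := by
    unfold badKeysC; rw [Finset.card_sigma]
    exact Finset.sum_le_sum fun S hS => le_card_fiber_badC h (Finset.mem_filter.1 hS).2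
  have h2 : (goodKeysC M m).card ≤ (K - 1) ! * ((confs m).filter fun S => M.Good S).card := by
    unfold goodKeysC; rw [Finset.card_sigma, mul_comm]
    exact Finset.sum_le_card_nsmul _ _ _ fun S _ => card_fiber_goodC
  exact h1.trans ((card_badKeysC_le h m).trans h2)

end Counting

/-- **`WeightedLemma` from a coded injection.**  This is the scheme-independent counting step of every injection proof of
`GadgetModelLemma`: it remains to construct `ψ` and `code` (memo: donation trees + gadget edges). [this work] -/
theorem weightedLemma_of_codeInjection [Fintype ι] (h : M.CodeInjection ψ code) : M.WeightedLemma := by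
  classical
  intro m
  convert sum_bad_le_of_codeInjection (M := M) h m

end Model

end GadgetModel

end Summit.CriticalPhenomena.PercolationContinuityZ3.Theorems.SunflowerPartition
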